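import Mathlib
import Literature.Topology.FourManifolds.LefschetzHandlebody
import Literature.Topology.FourManifolds.SmoothOrientation
import Literature.AlgebraicTopology.SingularHomology.SingularChains
import HarnessLib

/-!
# Stub `stub_modelsOnFibred_balance` (NF3), line `modp-braid-orbits` of crux
# `ConvexBisection.AcyclicBisectionExists` — genus zero: the base `Base 0 ≅ D² × D²` and its
# piece off the attaching circles are contractible

The registered stub `stub_modelsOnFibred_balance` is, verbatim unfolded, the named Literature fact
`Literature.Topology.FourManifolds.LefschetzBase.modelsOnFibred_balance_of_homotopyEquiv_sphere`
(Etnyre–Fuller 2006, eq. (d3): a fibred Lefschetz model `ModelsOnFibred M g l` of a homotopy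
4-sphere has exactly `2g` positive letters).  Its instance `g = 0` (`Base 0` is the 4-ball
`D² × D²`, every class is `0`, and the conclusion reads "no positive letters") is the one case
without Milnor-fibre input: there a fibred model of a homotopy 4-sphere has NO letters at all, by
`H₂(X(D²; l); ℚ) ≅ ℚ^{l.length}` (Mayer–Vietoris over Kosinski's cover of the multi-attachment
`X = Base 0 ∪ (2-handles)` by the base piece `jA (Base 0 ∖ ⋃ cores)` and the handles) and
`H₂(M; ℚ) = 0`.  This file PROVES the first input of that computation:

* `contractibleSpace_base_zero` — the genus-`0` base is contractible;
* `contractibleSpace_coresComplement_zero` — so is its piece `Base 0 ∖ ⋃ᵢ h̄ᵢ(S)` off the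
  attaching circles of any finite family of 2-handle attaching maps (the `jA`-piece of Kosinski's
  cover, whose reduced homology must vanish); more generally `contractibleSpace_of_forall_mem`:
  every subset of `Base 0` containing the interior `{rho 0 < 1/4}` is contractible.

The contraction is explicit (`baseZeroContraction`): in the coordinates `(w, y)`,
`w = y² − x − 1` — a polynomial automorphism of `ℂ²` for `g = 0` — the base
`{‖w‖² + eta ‖x‖² ≤ 1/4}` is star-shaped about `(x, y) = (−1, 0)`: the scaling
`(w, y) ↦ (t w, t y)`, i.e. `(x, y) ↦ (t² x + (t² − t) w + t² − 1, t y)`, does not increase `rho 0`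
(`rho_baseZeroContraction_le`: `‖t w‖ ≤ ‖w‖`, and `‖x_t‖ ≤ t² ‖x‖ + (t − t²)/2 + (1 − t²)` stays
`≤ 2` in the flat region and `≤ ‖x‖` outside it, so `eta ‖x_t‖² ≤ eta ‖x‖²`), and for `t < 1` it
lands in the interior `{rho 0 < 1/4}` (`rho_baseZeroContraction_lt`), hence off every subset of the
boundary — in particular off the attaching circles.

Companion file: `…StubModelsOnFibredBalanceSeam.lean` (the page condition of a fibred model binds
on the whole seam off the belt circles).  Nothing is asserted; the registered signature itself is
NOT proved here.

References: A. A. Kosinski, *Differential Manifolds* (1993), VI §6 [Kosinski1993];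
J. B. Etnyre, T. Fuller, IMRN 2006, §2 and eq. (d3) [EtnyreFuller2006].
-/

noncomputable section

set_option linter.dupNamespace false

open scoped Manifold ContDiff Topology
open Set Function Metric

namespace Summit.SmoothPoincare4.SmoothPoincare4.Theorems.AcyclicBisectionExists.ModpBraidOrbits

open Literature.Topology.FourManifolds Literature.Topology.FourManifolds.LefschetzBase
open Literature.Topology.FourManifolds.HandleAttachingMap

section GenusZero

/-- **The contraction of the genus-`0` base** read in `ℂ² = ℝ⁴`: `(x, y) ↦ (x_t, t y)` with
`x_t = t² x + (t² − t) w + (t² − 1)`, `w = y² − x − 1`, i.e. `(w, y) ↦ (t w, t y)` in the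
coordinates `(w, y)`. [folklore] -/
def baseZeroContraction (t : ℝ) (p : EuclideanSpace ℝ (Fin 4)) : EuclideanSpace ℝ (Fin 4) :=
  LefschetzBase.mk ((t : ℂ) ^ 2 * cx p + ((t : ℂ) ^ 2 - t) * w 0 p + ((t : ℂ) ^ 2 - 1))
    ((t : ℂ) * cy p)

/-- The `x`-coordinate of the contraction. [folklore] -/
@[simp] theorem cx_baseZeroContraction (t : ℝ) (p : EuclideanSpace ℝ (Fin 4)) :
    cx (baseZeroContraction t p) =
      (t : ℂ) ^ 2 * cx p + ((t : ℂ) ^ 2 - t) * w 0 p + ((t : ℂ) ^ 2 - 1) :=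
  cx_mk _ _

/-- The `y`-coordinate of the contraction. [folklore] -/
@[simp] theorem cy_baseZeroContraction (t : ℝ) (p : EuclideanSpace ℝ (Fin 4)) :
    cy (baseZeroContraction t p) = (t : ℂ) * cy p :=
  cy_mk _ _

/-- The contraction scales `w = y² − x − 1` by `t`. [folklore] -/
theorem w_baseZeroContraction (t : ℝ) (p : EuclideanSpace ℝ (Fin 4)) :
    w 0 (baseZeroContraction t p) = (t : ℂ) * w 0 p := by
  simp only [w, Phi, cx_baseZeroContraction, cy_baseZeroContraction, Nat.mul_zero, Nat.zero_add,
    pow_one]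
  ring

/-- At `t = 1` the contraction is the identity. [folklore] -/
@[simp] theorem baseZeroContraction_one (p : EuclideanSpace ℝ (Fin 4)) :
    baseZeroContraction 1 p = p := by
  have h : baseZeroContraction 1 p = LefschetzBase.mk (cx p) (cy p) := by
    simp [baseZeroContraction]
  rw [h, mk_cx_cy]

/-- At `t = 0` the contraction is the constant map at `(x, y) = (−1, 0)`. [folklore] -/
@[simp] theorem baseZeroContraction_zero (p : EuclideanSpace ℝ (Fin 4)) :
    baseZeroContraction 0 p = LefschetzBase.mk (-1) 0 := by
  simp [baseZeroContraction]

/-- The contraction is jointly continuous in `(t, p)`. [folklore] -/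
theorem continuous_baseZeroContraction :
    Continuous fun q : ℝ × EuclideanSpace ℝ (Fin 4) => baseZeroContraction q.1 q.2 := by
  have hcx : Continuous fun q : ℝ × EuclideanSpace ℝ (Fin 4) => cx q.2 :=
    contDiff_cx.continuous.comp continuous_snd
  have hcy : Continuous fun q : ℝ × EuclideanSpace ℝ (Fin 4) => cy q.2 :=
    contDiff_cy.continuous.comp continuous_snd
  have hw : Continuous fun q : ℝ × EuclideanSpace ℝ (Fin 4) => w 0 q.2 :=
    (contDiff_w 0).continuous.comp continuous_snd
  have ht : Continuous fun q : ℝ × EuclideanSpace ℝ (Fin 4) => ((q.1 : ℝ) : ℂ) :=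
    Complex.continuous_ofReal.comp continuous_fst
  exact continuous_mk.comp
    (((((ht.pow 2).mul hcx).add (((ht.pow 2).sub ht).mul hw)).add
      ((ht.pow 2).sub continuous_const)).prodMk (ht.mul hcy))

/-- The basic estimate `‖x_t‖ ≤ t² ‖x‖ + (t − t²) ‖w‖ + (1 − t²)` for `t ∈ [0, 1]`. [folklore] -/
theorem norm_cx_baseZeroContraction_le {t : ℝ} (ht0 : 0 ≤ t) (ht1 : t ≤ 1)
    (p : EuclideanSpace ℝ (Fin 4)) :
    ‖cx (baseZeroContraction t p)‖ ≤
      t ^ 2 * ‖cx p‖ + (t - t ^ 2) * ‖w 0 p‖ + (1 - t ^ 2) := by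
  rw [cx_baseZeroContraction]
  have h1 : ‖(t : ℂ) ^ 2 * cx p‖ = t ^ 2 * ‖cx p‖ := by
    rw [norm_mul, norm_pow, Complex.norm_real, Real.norm_eq_abs, sq_abs]
  have h2 : ‖((t : ℂ) ^ 2 - t) * w 0 p‖ = (t - t ^ 2) * ‖w 0 p‖ := by
    have e : ((t : ℂ) ^ 2 - t) = ((t ^ 2 - t : ℝ) : ℂ) := by push_cast; ring
    rw [norm_mul, e, Complex.norm_real, Real.norm_eq_abs, abs_of_nonpos (by nlinarith)]
    ring
  have h3 : ‖((t : ℂ) ^ 2 - 1)‖ = 1 - t ^ 2 := by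
    have e : ((t : ℂ) ^ 2 - 1) = ((t ^ 2 - 1 : ℝ) : ℂ) := by push_cast; ring
    rw [e, Complex.norm_real, Real.norm_eq_abs, abs_of_nonpos (by nlinarith)]
    ring
  have := norm_add₃_le (a := (t : ℂ) ^ 2 * cx p) (b := ((t : ℂ) ^ 2 - t) * w 0 p)
    (c := ((t : ℂ) ^ 2 - 1))
  linarith [h1, h2, h3]

/-- On the base (`‖w‖ ≤ 1/2`), if `‖x‖ ≤ 2` then `‖x_t‖ ≤ 2` (the flat region is preserved).
[folklore] -/
theorem norm_cx_baseZeroContraction_le_two {t : ℝ} (ht0 : 0 ≤ t) (ht1 : t ≤ 1)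
    {p : EuclideanSpace ℝ (Fin 4)}
    (hw : ‖w 0 p‖ ≤ 1 / 2) (hx : ‖cx p‖ ≤ 2) : ‖cx (baseZeroContraction t p)‖ ≤ 2 := by
  have h := norm_cx_baseZeroContraction_le ht0 ht1 p
  have h1 : t ^ 2 * ‖cx p‖ ≤ t ^ 2 * 2 := mul_le_mul_of_nonneg_left hx (sq_nonneg t)
  have h2 : (t - t ^ 2) * ‖w 0 p‖ ≤ (t - t ^ 2) * (1 / 2) :=
    mul_le_mul_of_nonneg_left hw (by nlinarith)
  nlinarith

/-- On the base (`‖w‖ ≤ 1/2`), if `2 ≤ ‖x‖` then `‖x_t‖ ≤ ‖x‖` (the contraction does not move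
outwards in `x`). [folklore] -/
theorem norm_cx_baseZeroContraction_le_norm {t : ℝ} (ht0 : 0 ≤ t) (ht1 : t ≤ 1)
    {p : EuclideanSpace ℝ (Fin 4)}
    (hw : ‖w 0 p‖ ≤ 1 / 2) (hx : 2 ≤ ‖cx p‖) : ‖cx (baseZeroContraction t p)‖ ≤ ‖cx p‖ := by
  have h := norm_cx_baseZeroContraction_le ht0 ht1 p
  have h2 : (t - t ^ 2) * ‖w 0 p‖ ≤ (t - t ^ 2) * (1 / 2) :=
    mul_le_mul_of_nonneg_left hw (by nlinarith)
  have h3 : (1 - t ^ 2) * 2 ≤ (1 - t ^ 2) * ‖cx p‖ :=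
    mul_le_mul_of_nonneg_left hx (by nlinarith)
  nlinarith

/-- The cut-off term does not increase along the contraction: `eta ‖x_t‖² ≤ eta ‖x‖²` on the base.
[folklore] -/
theorem eta_baseZeroContraction_le {t : ℝ} (ht0 : 0 ≤ t) (ht1 : t ≤ 1)
    {p : EuclideanSpace ℝ (Fin 4)}
    (hw : ‖w 0 p‖ ≤ 1 / 2) :
    eta (‖cx (baseZeroContraction t p)‖ ^ 2) ≤ eta (‖cx p‖ ^ 2) := by
  rcases le_total ‖cx p‖ 2 with hx | hx
  · have h := norm_cx_baseZeroContraction_le_two ht0 ht1 hw hx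
    rw [eta_of_le (by nlinarith [norm_nonneg (cx (baseZeroContraction t p))])]
    exact eta_nonneg _
  · have h := norm_cx_baseZeroContraction_le_norm ht0 ht1 hw hx
    exact eta_monotone (by nlinarith [norm_nonneg (cx (baseZeroContraction t p))])

/-- `‖w‖ ≤ 1/2` on the base. [folklore] -/
theorem norm_w_le_half {p : EuclideanSpace ℝ (Fin 4)} (hp : rho 0 p ≤ 1 / 4) : ‖w 0 p‖ ≤ 1 / 2 := by
  have h := (bounds_of_rho_le 0 hp).2
  nlinarith [norm_nonneg (w 0 p)]

/-- **The contraction preserves the base**: `rho 0 (x_t, t y) ≤ rho 0 (x, y)` for `t ∈ [0, 1]`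
on `{rho 0 ≤ 1/4}`. [folklore] -/
theorem rho_baseZeroContraction_le {t : ℝ} (ht0 : 0 ≤ t) (ht1 : t ≤ 1)
    {p : EuclideanSpace ℝ (Fin 4)}
    (hp : rho 0 p ≤ 1 / 4) : rho 0 (baseZeroContraction t p) ≤ rho 0 p := by
  have hw := norm_w_le_half hp
  have h1 : ‖w 0 (baseZeroContraction t p)‖ ^ 2 ≤ ‖w 0 p‖ ^ 2 := by
    rw [w_baseZeroContraction, norm_mul, Complex.norm_real, Real.norm_eq_abs, abs_of_nonneg ht0]
    have : t ^ 2 ≤ 1 := by nlinarith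
    nlinarith [norm_nonneg (w 0 p), sq_nonneg ‖w 0 p‖]
  have h2 := eta_baseZeroContraction_le ht0 ht1 hw
  unfold rho
  linarith

/-- The cut-off is strictly increasing beyond the flat region. [folklore] -/
theorem strictMonoOn_eta : StrictMonoOn eta (Ioi 4) :=
  strictMonoOn_of_deriv_pos (convex_Ioi 4) contDiff_eta.continuous.continuousOn fun x hx => by
    rw [interior_Ioi] at hx
    exact deriv_eta_pos hx

/-- **For `t < 1` the contraction lands in the interior** `{rho 0 < 1/4}` of the base. [folklore] -/
theorem rho_baseZeroContraction_lt {t : ℝ} (ht0 : 0 ≤ t) (ht1 : t < 1)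
    {p : EuclideanSpace ℝ (Fin 4)}
    (hp : rho 0 p ≤ 1 / 4) : rho 0 (baseZeroContraction t p) < 1 / 4 := by
  have hw := norm_w_le_half hp
  have ht2 : t ^ 2 < 1 := by nlinarith
  by_cases hw0 : w 0 p = 0
  · -- on the central page: `rho = eta ‖x‖²` before and after
    have hrho : rho 0 (baseZeroContraction t p) = eta (‖cx (baseZeroContraction t p)‖ ^ 2) := by
      simp [rho, w_baseZeroContraction, hw0]
    have hrho' : rho 0 p = eta (‖cx p‖ ^ 2) := by simp [rho, hw0]
    rw [hrho]
    rcases le_or_gt ‖cx p‖ 2 with hx | hx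
    · have h := norm_cx_baseZeroContraction_le_two ht0 ht1.le hw hx
      rw [eta_of_le (by nlinarith [norm_nonneg (cx (baseZeroContraction t p))])]
      norm_num
    · -- `‖x_t‖ ≤ t² ‖x‖ + (1 − t²) < ‖x‖`
      have h := norm_cx_baseZeroContraction_le ht0 ht1.le p
      rw [hw0, norm_zero, mul_zero, add_zero] at h
      have hlt : ‖cx (baseZeroContraction t p)‖ < ‖cx p‖ := by nlinarith
      rcases le_or_gt (‖cx (baseZeroContraction t p)‖ ^ 2) 4 with h4 | h4
      · rw [eta_of_le h4]; norm_num
      · have hsq : ‖cx (baseZeroContraction t p)‖ ^ 2 < ‖cx p‖ ^ 2 := by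
          nlinarith [norm_nonneg (cx (baseZeroContraction t p))]
        have := strictMonoOn_eta h4 (lt_trans h4 hsq) hsq
        linarith
  · have hpos : 0 < ‖w 0 p‖ := norm_pos_iff.2 hw0
    have h1 : ‖w 0 (baseZeroContraction t p)‖ ^ 2 < ‖w 0 p‖ ^ 2 := by
      rw [w_baseZeroContraction, norm_mul, Complex.norm_real, Real.norm_eq_abs, abs_of_nonneg ht0,
        mul_pow]
      have h3 : t ^ 2 * ‖w 0 p‖ ^ 2 < 1 * ‖w 0 p‖ ^ 2 := mul_lt_mul_of_pos_right ht2 (by positivity)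
      linarith
    have h2 := eta_baseZeroContraction_le ht0 ht1.le hw
    unfold rho at hp ⊢
    linarith

/-- The centre `(x, y) = (−1, 0)` of the contraction lies in the interior of the base
(`rho 0 = 0` there). [folklore] -/
theorem rho_centre : rho 0 (LefschetzBase.mk (-1) 0) = 0 := by
  simp [rho, w, Phi, eta_of_le]

/-- The centre of the contraction as a point of `Base 0`. [folklore] -/
def baseZeroCentre : Base 0 :=
  ⟨LefschetzBase.mk (-1) 0, by
    show rho 0 (LefschetzBase.mk (-1) 0) ≤ 1 / 4
    rw [rho_centre]; norm_num⟩

/-- The moving point of the contraction of a subset `S` of the base: at time `s` the point `q`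
is sent to `((1 − s) w, (1 − s) y)` in the coordinates `(w, y)`. [folklore] -/
def baseZeroMove (S : Set (Base 0)) (q : unitInterval × ↥S) : Base 0 :=
  RegularSublevel.mk (isRegularLevel_rho 0) (baseZeroContraction (1 - (q.1 : ℝ)) (q.2 : Base 0).1)
    ((rho_baseZeroContraction_le (t := 1 - (q.1 : ℝ)) (by linarith [q.1.2.2])
      (by linarith [q.1.2.1]) (q.2 : Base 0).2).trans (q.2 : Base 0).2)

/-- The underlying point of `baseZeroMove`. [folklore] -/
theorem baseZeroMove_coe (S : Set (Base 0)) (q : unitInterval × ↥S) :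
    (baseZeroMove S q).1 = baseZeroContraction (1 - (q.1 : ℝ)) (q.2 : Base 0).1 := rfl

/-- The moving point depends continuously on `(s, q)`. [folklore] -/
theorem continuous_baseZeroMove (S : Set (Base 0)) : Continuous (baseZeroMove S) := by
  have h1 : Continuous fun q : unitInterval × ↥S => (1 - (q.1 : ℝ), (q.2 : Base 0).1) :=
    (continuous_const.sub (continuous_subtype_val.comp continuous_fst)).prodMk
      (continuous_subtype_val.comp (continuous_subtype_val.comp continuous_snd))
  exact Continuous.subtype_mk (continuous_baseZeroContraction.comp h1) _

/-- At time `0` the moving point is `q` itself. [folklore] -/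
theorem baseZeroMove_zero (S : Set (Base 0)) (q : ↥S) : baseZeroMove S (0, q) = (q : Base 0) := by
  apply Subtype.ext
  rw [baseZeroMove_coe]
  change baseZeroContraction (1 - ((0 : unitInterval) : ℝ)) (q : Base 0).1 = (q : Base 0).1
  rw [Set.Icc.coe_zero, sub_zero, baseZeroContraction_one]

/-- At time `1` the moving point is the centre. [folklore] -/
theorem baseZeroMove_one (S : Set (Base 0)) (q : ↥S) : baseZeroMove S (1, q) = baseZeroCentre := by
  apply Subtype.ext
  rw [baseZeroMove_coe]
  change baseZeroContraction (1 - ((1 : unitInterval) : ℝ)) (q : Base 0).1 = LefschetzBase.mk (-1) 0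
  rw [Set.Icc.coe_one, sub_self, baseZeroContraction_zero]

/-- If `S` contains the interior of the base, the moving point stays in `S` (at time `0` it is
`q ∈ S`, at positive times it is interior). [folklore] -/
theorem baseZeroMove_mem {S : Set (Base 0)} (hS : ∀ q : Base 0, rho 0 q.1 < 1 / 4 → q ∈ S)
    (q : unitInterval × ↥S) : baseZeroMove S q ∈ S := by
  by_cases h0 : (q.1 : ℝ) = 0
  · have hq : q = (0, q.2) := Prod.ext (Subtype.ext h0) rfl
    rw [hq, baseZeroMove_zero]
    exact q.2.2
  · apply hS
    rw [baseZeroMove_coe]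
    have hpos : 0 < (q.1 : ℝ) := lt_of_le_of_ne q.1.2.1 (Ne.symm h0)
    exact rho_baseZeroContraction_lt (by linarith [q.1.2.2]) (by linarith) (q.2 : Base 0).2

/-- The contraction of `S` as a homotopy from the identity to the constant map at the centre.
[folklore] -/
def baseZeroHomotopy {S : Set (Base 0)} (hS : ∀ q : Base 0, rho 0 q.1 < 1 / 4 → q ∈ S)
    (hc : baseZeroCentre ∈ S) :
    ContinuousMap.Homotopy (ContinuousMap.id ↥S) (ContinuousMap.const ↥S ⟨baseZeroCentre, hc⟩) where
  toFun q := ⟨baseZeroMove S q, baseZeroMove_mem hS q⟩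
  continuous_toFun := (continuous_baseZeroMove S).subtype_mk _
  map_zero_left q := Subtype.ext (baseZeroMove_zero S q)
  map_one_left q := Subtype.ext (baseZeroMove_one S q)

/-- **A subset of the genus-`0` base containing its interior is contractible** — in particular
the complement of any subset of the boundary: the contraction `(w, y) ↦ ((1 − s) w, (1 − s) y)`
runs inside the interior for `s > 0` and ends at the centre `(−1, 0)`. [folklore] -/
theorem contractibleSpace_of_forall_mem (S : Set (Base 0))
    (hS : ∀ q : Base 0, rho 0 q.1 < 1 / 4 → q ∈ S) : ContractibleSpace ↥S := by
  have hcS : baseZeroCentre ∈ S :=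
    hS _ (by rw [show (baseZeroCentre).1 = LefschetzBase.mk (-1) 0 from rfl, rho_centre]; norm_num)
  rw [contractible_iff_id_nullhomotopic]
  exact ⟨⟨baseZeroCentre, hcS⟩, ⟨baseZeroHomotopy hS hcS⟩⟩

/-- **The genus-`0` base `Base 0 ≅ D² × D²` is contractible.** [folklore] -/
theorem contractibleSpace_base_zero : ContractibleSpace (Base 0) :=
  haveI := contractibleSpace_of_forall_mem (univ : Set (Base 0)) fun _ _ => mem_univ _
  (Homeomorph.Set.univ (Base 0)).symm.contractibleSpace

/-- **The base piece `Base 0 ∖ ⋃ᵢ h̄ᵢ(S)` of a genus-`0` Lefschetz handlebody is contractible**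
(the attaching circles lie in the boundary, which the contraction leaves at once): the input
`H̃_*(jA(Base 0 ∖ ⋃ cores)) = 0` of the Mayer–Vietoris computation of `H₂(X(D²; l))` over Kosinski's
cover. [folklore] -/
theorem contractibleSpace_coresComplement_zero {ι : Type*} [Finite ι]
    (h : ι → HandleAttachingMap 3 2 (Base 0)) : ContractibleSpace ↥(coresComplement h) := by
  refine contractibleSpace_of_forall_mem (coresComplement h : Set (Base 0)) fun q hq => ?_
  rw [SetLike.mem_coe, mem_coresComplement]
  intro i hi
  have hb : q ∈ (𝓡∂ 4).boundary (Base 0) := (h i).core_subset_boundary hi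
  rw [RegularSublevel.mem_boundary_iff] at hb
  exact hq.ne hb

/-- **Registered sub-goal `stub_contractibleSpace_coresComplement_zero` of
`stub_modelsOnFibred_balance`** (genus `0`, families indexed by `Fin n` as in
`IsLefschetzHandlebody` / `ModelsOnFibred`): the base piece `Base 0 ∖ ⋃ᵢ h̄ᵢ(S)` of a genus-`0`
Lefschetz handlebody is contractible. [folklore] -/
theorem stub_contractibleSpace_coresComplement_zero :
    ∀ (n : ℕ) (h : Fin n → HandleAttachingMap 3 2 (Base 0)),
      ContractibleSpace ↥(HandleAttachingMap.coresComplement h) :=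
  fun _ h => contractibleSpace_coresComplement_zero h

end GenusZero

end Summit.SmoothPoincare4.SmoothPoincare4.Theorems.AcyclicBisectionExists.ModpBraidOrbits
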